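import Literature.AlgebraicGeometry.HodgeTheory.AbelianVarietyEndomorphismMappingDegree
import Literature.AlgebraicGeometry.HodgeTheory.AbelianVarietyCyclotomicAutomorphismDegreeNorm
import HarnessLib

/-!
# Endomorphisms of a complex abelian variety are similitudes of every integral cup pairing, with multiplier the degree:
# `⟨f^*x ⌣ f^*y, [A(ℂ)]⟩ = deg f · ⟨x ⌣ y, [A(ℂ)]⟩`; automorphisms are isometries; isogenies act injectively on `H•(A(ℂ); ℤ)`

Layer `Literature/AlgebraicGeometry/HodgeTheory`, namespace `Literature.AlgebraicGeometry.HodgeTheory` (theorems in the `AbelianVariety`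
namespace).  THEOREMS ONLY (no definition, no named fact, net debt 0).  Sequel of `AbelianVarietyEndomorphismMappingDegree` (seat p31:
`AbelianVariety.hasDegree_natCard_kerPoints` — `f(ℂ)_*[A(ℂ)]_μ = deg f · [A(ℂ)]_μ`, the mapping degree of `f(ℂ)` is the algebraic degree
`deg f = |Ker f(ℂ)|` (or `0`)) on the lane's algebraic Betti carrier `ComplexPoints A.X` with integral coefficients and the cup pairings
`cupPairing μ h x y = ⟨x ⌣ y, [A(ℂ)]_μ⟩`.

H. Lange, *Abelian Varieties over the Complex Numbers* (2023), §1.7, proof of Cor. 1.7.6 (PDF p. 73), the transformation formula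
«`∫_Y ⋀^g c₁(f^*L) = (Λ : ρ_r(f)(Λ′)) ∫_X ⋀^g c₁(L) = deg f · (L^g)`»; §1.1.2 Prop. 1.1.13 (c) (`deg f = det ρ_r(f)`) and Prop. 1.1.15 (PDF p. 22).
A. Hatcher, *Algebraic Topology* (2002), §3.1 p. 201 (naturality `⟨f^*a, c⟩ = ⟨a, f_*c⟩`), §3.2 Prop. 3.10 (`f^*(α ⌣ β) = f^*α ⌣ f^*β`), §3.3
Thm. 3.26 and Exercises 7–8 (the degree), Prop. 3.38 (non-singularity of the cup pairing over `ℤ` modulo torsion).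

## What is proved

For `A : AbelianVariety ℂ`, an endomorphism `f : A ⟶ A` with `f(ℂ) = AlgPoints.mapContinuous f.hom.hom.hom`, `deg f = Nat.card (Ker f(ℂ))`, every
`μ : HomologicalOrientation ℤ (ComplexPoints A.X) (2 * A.dim)`:

* §1 `kroneckerPairing_map_fundamentalClass` — `⟨f(ℂ)^* z, [A(ℂ)]_μ⟩ = deg f · ⟨z, [A(ℂ)]_μ⟩` (`z ∈ H^{2g}(A(ℂ); ℤ)`);
  **`cupPairing_map_map`** — `⟨f^*x ⌣ f^*y, [A(ℂ)]_μ⟩ = deg f · ⟨x ⌣ y, [A(ℂ)]_μ⟩` for all complementary degrees `k + l = 2g`; `cupPairing_map_self`;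
* §2 automorphisms: `natCard_kerPoints_eq_one_of_isIso` (`deg u = 1`), **`cupPairing_map_map_of_isIso`** (`u^*` preserves every cup pairing),
  `singularCohomology_map_top_of_isIso` (`u^* = id` on `H^{2g}(A(ℂ); ℤ)`);
* §3 isogenies: **`singularCohomology_map_injective_of_natCard_kerPoints_ne_zero`** — for `deg f ≠ 0`, `f(ℂ)^* : Hᵏ(A(ℂ); ℤ) → Hᵏ(A(ℂ); ℤ)` is
  injective for EVERY `k` (Poincaré duality over `ℤ`: `deg f · ⟨x ⌣ y, [A]⟩ = ⟨f^*x ⌣ f^*y, [A]⟩` and the cup pairing of `A(ℂ)` is perfect);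
  `cupPairing_map_map_eq_zero_iff` (`⟨f^*x ⌣ f^*y, [A]⟩ = 0 ↔ ⟨x ⌣ y, [A]⟩ = 0` for isogenies).

## References

* [Lange2023AbelianVarietiesComplex] H. Lange, *Abelian Varieties over the Complex Numbers*, Springer 2023 — §1.1.2 Prop. 1.1.13 (c), Prop. 1.1.15
  (PDF p. 22); §1.7 proof of Cor. 1.7.6 (PDF p. 73).
* [HatcherAT2002] A. Hatcher, *Algebraic Topology*, CUP 2002 — §3.1 p. 201; §3.2 Prop. 3.10; §3.3 Thm. 3.26, Exercises 7–8, Prop. 3.38.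

## Provenance
Lane `lit-hodgefound` (Hodge path, Track 2), prover seat `lit-hodgefound-p21` (generation 43), self-proposed row g43-#9 (CLAIM BY PATH).
-/

noncomputable section

open CategoryTheory Module Function
open Literature.AlgebraicTopology.SingularHomology

namespace Literature.AlgebraicGeometry.HodgeTheory

open Literature.AlgebraicGeometry.Motives (ComplexPoints IsSmoothProjective AbelianVariety SchemeOver AlgPoints specOver)
open Literature.AlgebraicGeometry.Motives.AbelianVariety (Hom.kerPoints)

namespace AbelianVariety

variable (A : AbelianVariety ℂ)

/-! ### §1 The transformation formula: `f^*` multiplies every top-degree pairing by `deg f` -/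

/-- **`⟨f(ℂ)^* z, [A(ℂ)]_μ⟩ = deg f · ⟨z, [A(ℂ)]_μ⟩`** for every `z ∈ H^{2g}(A(ℂ); ℤ)`, every endomorphism `f` and every orientation `μ`
(`⟨f^*z, [A]⟩ = ⟨z, f_*[A]⟩` and `f_*[A(ℂ)]_μ = deg f · [A(ℂ)]_μ`). [cite: Lange2023AbelianVarietiesComplex, §1.7 proof of Cor. 1.7.6 (PDF p. 73)]
[cite: HatcherAT2002, §3.1 p. 201 and §3.3 Exercises 7–8] -/
theorem kroneckerPairing_map_fundamentalClass (f : A ⟶ A) (μ : HomologicalOrientation ℤ (ComplexPoints A.X) (2 * A.dim))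
    (z : singularCohomology ℤ ℤ (ComplexPoints A.X) (2 * A.dim)) :
    kroneckerPairing ℤ ℤ (ComplexPoints A.X) (2 * A.dim)
        (singularCohomology.map ℤ ℤ (AlgPoints.mapContinuous (L := ℂ) f.hom.hom.hom) (2 * A.dim) z) μ.fundamentalClass =
      (Nat.card (Hom.kerPoints (specOver ℂ ℂ) f) : ℤ) * kroneckerPairing ℤ ℤ (ComplexPoints A.X) (2 * A.dim) z μ.fundamentalClass := by
  have hd := hasDegree_natCard_kerPoints A f μ
  rw [HasDegree] at hd
  rw [kroneckerPairing_map, hd, map_zsmul, smul_eq_mul]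

/-- **ENDOMORPHISMS ARE SIMILITUDES OF EVERY CUP PAIRING, WITH MULTIPLIER THE DEGREE: `⟨f^*x ⌣ f^*y, [A(ℂ)]_μ⟩ = deg f · ⟨x ⌣ y, [A(ℂ)]_μ⟩`** for all
complementary degrees `k + l = 2g`, all integral classes `x ∈ Hᵏ(A(ℂ); ℤ)`, `y ∈ Hˡ(A(ℂ); ℤ)`, every endomorphism `f` (`deg f = |Ker f(ℂ)|`, or `0`) and
every orientation `μ` — Lange's transformation formula «`∫_Y f^*η = deg f · ∫_X η`» with `f^*(x ⌣ y) = f^*x ⌣ f^*y`.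
[cite: Lange2023AbelianVarietiesComplex, §1.7 proof of Cor. 1.7.6 (PDF p. 73) and §1.1.2 Prop. 1.1.13 (c) (PDF p. 22)] [cite: HatcherAT2002, §3.2 Prop. 3.10 and §3.1 p. 201] -/
theorem cupPairing_map_map (f : A ⟶ A) (μ : HomologicalOrientation ℤ (ComplexPoints A.X) (2 * A.dim)) {k l : ℕ} (h : k + l = 2 * A.dim)
    (x : singularCohomology ℤ ℤ (ComplexPoints A.X) k) (y : singularCohomology ℤ ℤ (ComplexPoints A.X) l) :
    cupPairing μ h (singularCohomology.map ℤ ℤ (AlgPoints.mapContinuous (L := ℂ) f.hom.hom.hom) k x)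
        (singularCohomology.map ℤ ℤ (AlgPoints.mapContinuous (L := ℂ) f.hom.hom.hom) l y) =
      (Nat.card (Hom.kerPoints (specOver ℂ ℂ) f) : ℤ) * cupPairing μ h x y := by
  rw [cupPairing_apply, cupPairing_apply, ← cupProduct_map, kroneckerPairing_map_fundamentalClass]

/-- **Self-intersection numbers scale by the degree: `⟨f^*x ⌣ f^*x, [A(ℂ)]⟩ = deg f · ⟨x ⌣ x, [A(ℂ)]⟩`** (middle degree `g + g = 2g`).
[cite: Lange2023AbelianVarietiesComplex, §1.7 proof of Cor. 1.7.6 (PDF p. 73)] -/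
theorem cupPairing_map_self (f : A ⟶ A) (μ : HomologicalOrientation ℤ (ComplexPoints A.X) (2 * A.dim)) (h : A.dim + A.dim = 2 * A.dim)
    (x : singularCohomology ℤ ℤ (ComplexPoints A.X) A.dim) :
    cupPairing μ h (singularCohomology.map ℤ ℤ (AlgPoints.mapContinuous (L := ℂ) f.hom.hom.hom) A.dim x)
        (singularCohomology.map ℤ ℤ (AlgPoints.mapContinuous (L := ℂ) f.hom.hom.hom) A.dim x) =
      (Nat.card (Hom.kerPoints (specOver ℂ ℂ) f) : ℤ) * cupPairing μ h x x :=
  cupPairing_map_map A f μ h x x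

/-! ### §2 Automorphisms preserve every cup pairing -/

/-- The degree of an automorphism is `1`: `|Ker u(ℂ)| = 1`. [cite: Lange2023AbelianVarietiesComplex, §1.1.2 Prop. 1.1.15 (PDF p. 22)] -/
theorem natCard_kerPoints_eq_one_of_isIso (u : A ⟶ A) [IsIso u] : Nat.card (Hom.kerPoints (specOver ℂ ℂ) u) = 1 := by
  rw [kerPoints_eq_bot_of_isIso u (specOver ℂ ℂ)]
  exact Subgroup.card_bot

/-- **AUTOMORPHISMS ARE ISOMETRIES OF EVERY CUP PAIRING: `⟨u^*x ⌣ u^*y, [A(ℂ)]_μ⟩ = ⟨x ⌣ y, [A(ℂ)]_μ⟩`** for an automorphism `u` of `A`, all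
complementary degrees and every orientation (`deg u = 1`). [cite: Lange2023AbelianVarietiesComplex, §1.7 proof of Cor. 1.7.6 (PDF p. 73) and §1.1.2 Prop. 1.1.15]
[cite: HatcherAT2002, §3.2 Prop. 3.10] -/
theorem cupPairing_map_map_of_isIso (u : A ⟶ A) [IsIso u] (μ : HomologicalOrientation ℤ (ComplexPoints A.X) (2 * A.dim)) {k l : ℕ}
    (h : k + l = 2 * A.dim) (x : singularCohomology ℤ ℤ (ComplexPoints A.X) k) (y : singularCohomology ℤ ℤ (ComplexPoints A.X) l) :
    cupPairing μ h (singularCohomology.map ℤ ℤ (AlgPoints.mapContinuous (L := ℂ) u.hom.hom.hom) k x)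
        (singularCohomology.map ℤ ℤ (AlgPoints.mapContinuous (L := ℂ) u.hom.hom.hom) l y) = cupPairing μ h x y := by
  rw [cupPairing_map_map, natCard_kerPoints_eq_one_of_isIso, Nat.cast_one, one_mul]

/-- **An automorphism acts trivially on `H^{2g}(A(ℂ); ℤ)`** (`u^* = deg u = 1` in top degree). [cite: Lange2023AbelianVarietiesComplex, §1.7 proof of Cor. 1.7.6 (PDF p. 73)] -/
theorem singularCohomology_map_top_of_isIso (u : A ⟶ A) [IsIso u] (y : singularCohomology ℤ ℤ (ComplexPoints A.X) (2 * A.dim)) :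
    singularCohomology.map ℤ ℤ (AlgPoints.mapContinuous (L := ℂ) u.hom.hom.hom) (2 * A.dim) y = y := by
  rw [singularCohomology_map_top_eq_natCard_kerPoints_smul, natCard_kerPoints_eq_one_of_isIso, Nat.cast_one, one_smul]

/-! ### §3 Isogenies act injectively on integral cohomology -/

/-- **ISOGENIES ACT INJECTIVELY ON `Hᵏ(A(ℂ); ℤ)`, EVERY `k`**: if `deg f = |Ker f(ℂ)| ≠ 0` then `f(ℂ)^* : Hᵏ(A(ℂ); ℤ) → Hᵏ(A(ℂ); ℤ)` is injective —
for `k ≤ 2g`, `deg f · ⟨x ⌣ y, [A]⟩ = ⟨f^*x ⌣ f^*y, [A]⟩` for all `y` of the complementary degree and the cup pairing of `A(ℂ)` is perfect over `ℤ`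
(`Hᵏ(A(ℂ); ℤ)` torsion-free, Poincaré duality); for `k > 2g`, `Hᵏ = 0`. [cite: Lange2023AbelianVarietiesComplex, §1.7 proof of Cor. 1.7.6 (PDF p. 73) and §1.1.2 (PDF pp. 20–22)]
[cite: HatcherAT2002, §3.3 Prop. 3.38] -/
theorem singularCohomology_map_injective_of_natCard_kerPoints_ne_zero (f : A ⟶ A) (hf : Nat.card (Hom.kerPoints (specOver ℂ ℂ) f) ≠ 0)
    (k : ℕ) : Injective (singularCohomology.map ℤ ℤ (AlgPoints.mapContinuous (L := ℂ) f.hom.hom.hom) k) := by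
  by_cases hk : k ≤ 2 * A.dim
  · have hpq : k + (2 * A.dim - k) = 2 * A.dim := by omega
    haveI := isPerfPair_cupPairing_int A hpq
    set μ := complexOrientationInt (AbelianVariety.isSmoothProjective_holds (A := A))
    have hd : (Nat.card (Hom.kerPoints (specOver ℂ ℂ) f) : ℤ) ≠ 0 := Nat.cast_ne_zero.2 hf
    intro x x' hxx'
    refine (LinearMap.IsPerfPair.bijective_left (cupPairing μ hpq)).1 (LinearMap.ext fun y ↦ ?_)
    have h1 := cupPairing_map_map A f μ hpq x y
    have h2 := cupPairing_map_map A f μ hpq x' y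
    rw [hxx'] at h1
    exact mul_left_cancel₀ hd (h1.symm.trans h2)
  · haveI := subsingleton_singularCohomology_int_of_lt A (by omega : 2 * A.dim < k)
    exact injective_of_subsingleton _

/-- **For an isogeny, `⟨f^*x ⌣ f^*y, [A(ℂ)]⟩ = 0 ↔ ⟨x ⌣ y, [A(ℂ)]⟩ = 0`** (the pairing is multiplied by the non-zero integer `deg f`).
[cite: Lange2023AbelianVarietiesComplex, §1.7 proof of Cor. 1.7.6 (PDF p. 73)] -/
theorem cupPairing_map_map_eq_zero_iff (f : A ⟶ A) (hf : Nat.card (Hom.kerPoints (specOver ℂ ℂ) f) ≠ 0)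
    (μ : HomologicalOrientation ℤ (ComplexPoints A.X) (2 * A.dim)) {k l : ℕ} (h : k + l = 2 * A.dim)
    (x : singularCohomology ℤ ℤ (ComplexPoints A.X) k) (y : singularCohomology ℤ ℤ (ComplexPoints A.X) l) :
    cupPairing μ h (singularCohomology.map ℤ ℤ (AlgPoints.mapContinuous (L := ℂ) f.hom.hom.hom) k x)
        (singularCohomology.map ℤ ℤ (AlgPoints.mapContinuous (L := ℂ) f.hom.hom.hom) l y) = 0 ↔ cupPairing μ h x y = 0 := by
  rw [cupPairing_map_map, mul_eq_zero, or_iff_right (Nat.cast_ne_zero.2 hf)]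

end AbelianVariety

end Literature.AlgebraicGeometry.HodgeTheory

end
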